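import Mathlib
import Summits.Ventures.PercRepro2.Graph
import Summits.Ventures.PercRepro2.RestrictClosure
import Summits.Ventures.PercRepro2.SepThreeReach

/-!
# The (SEP-3) class, II: the gate formulas of the five marks
(blind cell PercRepro2, typer-1 g49; LEAD-SEP3.md §1, S3-CLASSES §S3.8 and (G7))

With `A = {a₁, a₃}`, `K = C_{G − A}(o)`, `C₁` / `C₂` the connections inside `F₁ = touches K` /
`F₂ = F₁ᶜ` (`SepThreeReach.lean`), and `a₂, b ∉ K ∪ A`, the ten connection atoms of the
five-point functional read on the two blocks — e.g.

* **(G1)** `a₁ ↔ a₂ ⟺ C₂ a₁ a₂ ∨ (C₁ a₁ a₃ ∧ C₂ a₃ a₂)` (the lead's «`a₁ ~ a₂` iff `a₁ ~_b a₂`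
  or `X ∧ a₃ ~_b a₂`», `X = {a₁ ~_o a₃}`);
* **(G2)** `a₁ ↔ o ⟺ C₁ o a₁ ∨ (C₁ o a₃ ∧ C₂ a₃ a₁)`, **(G3)** `a₂ ↔ o ⟺ (C₁ o a₁ ∧ C₂ a₁ a₂) ∨
  (C₁ o a₃ ∧ C₂ a₃ a₂)`;
* **(G4)**–**(G7)** the `b`- and `a₃`-connections.

Each is the alternating-path formula with the gates enumerated.  Own work; standard axioms.
-/

namespace Summit.Ventures.PercRepro2

namespace SepThreeGcZero

open SepPair

/-! ## The gate formulas for the five marks (`a₂, b ∉ K ∪ A`) -/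

section Gates

variable {V : Type*} {E : Type*} {ends : E → Sym2 V} {o a₁ a₂ a₃ b : V}
  [DecidablePred (· ∈ touches ends (cluster ends (sepConfig ends {a₁, a₃}) o))]
  [DecidablePred (· ∈ (touches ends (cluster ends (sepConfig ends {a₁, a₃}) o))ᶜ)]

/-- **(G1)** `a₁ ↔ a₂ ⟺ C₂ a₁ a₂ ∨ (C₁ a₁ a₃ ∧ C₂ a₃ a₂)`. -/
theorem conn_a₁a₂_iff (ho : o ∉ ({a₁, a₃} : Set V))
    (h₂ : a₂ ∉ cluster ends (sepConfig ends {a₁, a₃}) o ∪ {a₁, a₃}) (ω : Config E) :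
    Conn ends ω a₁ a₂ ↔
      Conn ends (restrictTo (touches ends (cluster ends (sepConfig ends {a₁, a₃}) o))ᶜ ω) a₁ a₂ ∨
      (Conn ends (restrictTo (touches ends (cluster ends (sepConfig ends {a₁, a₃}) o)) ω) a₁ a₃ ∧
        Conn ends (restrictTo (touches ends (cluster ends (sepConfig ends {a₁, a₃}) o))ᶜ ω) a₃ a₂) := by
  have ha₁ : a₁ ∈ ({a₁, a₃} : Set V) := by simp
  have ha₃ : a₃ ∈ ({a₁, a₃} : Set V) := by simp
  rw [conn_iff_of_not_mem ho (not_mem_cluster_of_mem_pair ho ha₁) ω a₂]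
  constructor
  · rintro (h | ⟨k, hk, _, hk₂⟩ | ⟨k, hk, k', hk', h₁k, hkk', hk'₂⟩)
    · exact Or.inl h
    · exact absurd hk₂ (not_conn_restrictTo_of_not_mem_union ho (Or.inr hk) h₂ ω)
    · simp only [Set.mem_insert_iff, Set.mem_singleton_iff] at hk hk'
      rcases hk with rfl | rfl <;> rcases hk' with rfl | rfl
      · exact Or.inl hk'₂
      · exact Or.inr ⟨hkk', hk'₂⟩
      · exact Or.inl hk'₂
      · exact Or.inl (conn_trans h₁k hk'₂)
  · rintro (h | ⟨hX, hY⟩)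
    · exact Or.inl h
    · exact Or.inr (Or.inr ⟨a₁, ha₁, a₃, ha₃, conn_refl _ _ _, hX, hY⟩)

/-- **(G2)** `a₁ ↔ o ⟺ C₁ o a₁ ∨ (C₁ o a₃ ∧ C₂ a₃ a₁)`. -/
theorem conn_a₁o_iff (ho : o ∉ ({a₁, a₃} : Set V)) (ω : Config E) :
    Conn ends ω a₁ o ↔
      Conn ends (restrictTo (touches ends (cluster ends (sepConfig ends {a₁, a₃}) o)) ω) o a₁ ∨
      (Conn ends (restrictTo (touches ends (cluster ends (sepConfig ends {a₁, a₃}) o)) ω) o a₃ ∧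
        Conn ends (restrictTo (touches ends (cluster ends (sepConfig ends {a₁, a₃}) o))ᶜ ω) a₃ a₁) := by
  have ha₃ : a₃ ∈ ({a₁, a₃} : Set V) := by simp
  rw [conn_comm a₁ o, conn_iff_of_mem_union ho (Or.inl (mem_cluster_self _ _ _)) ω a₁]
  constructor
  · rintro (h | ⟨k, hk, hok, hk₁⟩ | ⟨k, hk, k', hk', hok, hkk', hk'₁⟩)
    · exact Or.inl h
    · simp only [Set.mem_insert_iff, Set.mem_singleton_iff] at hk
      rcases hk with rfl | rfl
      · exact Or.inl hok
      · exact Or.inr ⟨hok, hk₁⟩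
    · simp only [Set.mem_insert_iff, Set.mem_singleton_iff] at hk hk'
      rcases hk with rfl | rfl <;> rcases hk' with rfl | rfl
      · exact Or.inl hok
      · exact Or.inl hok
      · exact Or.inr ⟨hok, hkk'⟩
      · exact Or.inl (conn_trans hok hk'₁)
  · rintro (h | ⟨hβ, hY⟩)
    · exact Or.inl h
    · exact Or.inr (Or.inl ⟨a₃, ha₃, hβ, hY⟩)

/-- **(G3)** `a₂ ↔ o ⟺ (C₁ o a₁ ∧ C₂ a₁ a₂) ∨ (C₁ o a₃ ∧ C₂ a₃ a₂)`. -/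
theorem conn_a₂o_iff (ho : o ∉ ({a₁, a₃} : Set V))
    (h₂ : a₂ ∉ cluster ends (sepConfig ends {a₁, a₃}) o ∪ {a₁, a₃}) (ω : Config E) :
    Conn ends ω a₂ o ↔
      (Conn ends (restrictTo (touches ends (cluster ends (sepConfig ends {a₁, a₃}) o)) ω) o a₁ ∧
        Conn ends (restrictTo (touches ends (cluster ends (sepConfig ends {a₁, a₃}) o))ᶜ ω) a₁ a₂) ∨
      (Conn ends (restrictTo (touches ends (cluster ends (sepConfig ends {a₁, a₃}) o)) ω) o a₃ ∧
        Conn ends (restrictTo (touches ends (cluster ends (sepConfig ends {a₁, a₃}) o))ᶜ ω) a₃ a₂) := by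
  have ha₁ : a₁ ∈ ({a₁, a₃} : Set V) := by simp
  have ha₃ : a₃ ∈ ({a₁, a₃} : Set V) := by simp
  have hoK : o ∈ cluster ends (sepConfig ends {a₁, a₃}) o ∪ {a₁, a₃} :=
    Or.inl (mem_cluster_self _ _ _)
  rw [conn_comm a₂ o, conn_iff_of_mem_union ho hoK ω a₂]
  constructor
  · rintro (h | ⟨k, hk, hok, hk₂⟩ | ⟨k, hk, k', hk', _, _, hk'₂⟩)
    · exact absurd h (not_conn_restrictTo_of_not_mem_union ho hoK h₂ ω)
    · simp only [Set.mem_insert_iff, Set.mem_singleton_iff] at hk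
      rcases hk with rfl | rfl
      · exact Or.inl ⟨hok, hk₂⟩
      · exact Or.inr ⟨hok, hk₂⟩
    · exact absurd hk'₂ (not_conn_restrictTo_of_not_mem_union ho (Or.inr hk') h₂ ω)
  · rintro (⟨hα, hY⟩ | ⟨hβ, hY⟩)
    · exact Or.inr (Or.inl ⟨a₁, ha₁, hα, hY⟩)
    · exact Or.inr (Or.inl ⟨a₃, ha₃, hβ, hY⟩)

/-- **(G4)** `a₁ ↔ b ⟺ C₂ b a₁ ∨ (C₂ b a₃ ∧ C₁ a₁ a₃)`. -/
theorem conn_a₁b_iff (ho : o ∉ ({a₁, a₃} : Set V))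
    (hb : b ∉ cluster ends (sepConfig ends {a₁, a₃}) o) (ω : Config E) :
    Conn ends ω a₁ b ↔
      Conn ends (restrictTo (touches ends (cluster ends (sepConfig ends {a₁, a₃}) o))ᶜ ω) b a₁ ∨
      (Conn ends (restrictTo (touches ends (cluster ends (sepConfig ends {a₁, a₃}) o))ᶜ ω) b a₃ ∧
        Conn ends (restrictTo (touches ends (cluster ends (sepConfig ends {a₁, a₃}) o)) ω) a₁ a₃) := by
  have ha₃ : a₃ ∈ ({a₁, a₃} : Set V) := by simp
  rw [conn_comm a₁ b, conn_iff_of_not_mem ho hb ω a₁]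
  constructor
  · rintro (h | ⟨k, hk, hbk, hk₁⟩ | ⟨k, hk, k', hk', hbk, hkk', hk'₁⟩)
    · exact Or.inl h
    · simp only [Set.mem_insert_iff, Set.mem_singleton_iff] at hk
      rcases hk with rfl | rfl
      · exact Or.inl hbk
      · exact Or.inr ⟨hbk, conn_symm hk₁⟩
    · simp only [Set.mem_insert_iff, Set.mem_singleton_iff] at hk hk'
      rcases hk with rfl | rfl <;> rcases hk' with rfl | rfl
      · exact Or.inl hbk
      · exact Or.inl hbk
      · exact Or.inr ⟨hbk, conn_symm hkk'⟩
      · exact Or.inl (conn_trans hbk hk'₁)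
  · rintro (h | ⟨hb₃, hX⟩)
    · exact Or.inl h
    · exact Or.inr (Or.inl ⟨a₃, ha₃, hb₃, conn_symm hX⟩)

/-- **(G5)** `a₂ ↔ b ⟺ C₂ b a₂ ∨ (C₁ a₁ a₃ ∧ ((C₂ b a₁ ∧ C₂ a₃ a₂) ∨ (C₂ b a₃ ∧ C₂ a₁ a₂)))`. -/
theorem conn_a₂b_iff (ho : o ∉ ({a₁, a₃} : Set V))
    (h₂ : a₂ ∉ cluster ends (sepConfig ends {a₁, a₃}) o ∪ {a₁, a₃})
    (hb : b ∉ cluster ends (sepConfig ends {a₁, a₃}) o) (ω : Config E) :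
    Conn ends ω a₂ b ↔
      Conn ends (restrictTo (touches ends (cluster ends (sepConfig ends {a₁, a₃}) o))ᶜ ω) b a₂ ∨
      (Conn ends (restrictTo (touches ends (cluster ends (sepConfig ends {a₁, a₃}) o)) ω) a₁ a₃ ∧
        ((Conn ends (restrictTo (touches ends (cluster ends (sepConfig ends {a₁, a₃}) o))ᶜ ω) b a₁ ∧
          Conn ends (restrictTo (touches ends (cluster ends (sepConfig ends {a₁, a₃}) o))ᶜ ω) a₃ a₂) ∨
        (Conn ends (restrictTo (touches ends (cluster ends (sepConfig ends {a₁, a₃}) o))ᶜ ω) b a₃ ∧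
          Conn ends (restrictTo (touches ends (cluster ends (sepConfig ends {a₁, a₃}) o))ᶜ ω) a₁ a₂))) := by
  have ha₁ : a₁ ∈ ({a₁, a₃} : Set V) := by simp
  have ha₃ : a₃ ∈ ({a₁, a₃} : Set V) := by simp
  rw [conn_comm a₂ b, conn_iff_of_not_mem ho hb ω a₂]
  constructor
  · rintro (h | ⟨k, hk, _, hk₂⟩ | ⟨k, hk, k', hk', hbk, hkk', hk'₂⟩)
    · exact Or.inl h
    · exact absurd hk₂ (not_conn_restrictTo_of_not_mem_union ho (Or.inr hk) h₂ ω)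
    · simp only [Set.mem_insert_iff, Set.mem_singleton_iff] at hk hk'
      rcases hk with rfl | rfl <;> rcases hk' with rfl | rfl
      · exact Or.inl (conn_trans hbk hk'₂)
      · exact Or.inr ⟨hkk', Or.inl ⟨hbk, hk'₂⟩⟩
      · exact Or.inr ⟨conn_symm hkk', Or.inr ⟨hbk, hk'₂⟩⟩
      · exact Or.inl (conn_trans hbk hk'₂)
  · rintro (h | ⟨hX, ⟨hb₁, hY⟩ | ⟨hb₃, hY⟩⟩)
    · exact Or.inl h
    · exact Or.inr (Or.inr ⟨a₁, ha₁, a₃, ha₃, hb₁, hX, hY⟩)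
    · exact Or.inr (Or.inr ⟨a₃, ha₃, a₁, ha₁, hb₃, conn_symm hX, hY⟩)

/-- **(G6)** `a₁ ↔ a₃ ⟺ C₁ a₁ a₃ ∨ C₂ a₁ a₃`. -/
theorem conn_a₁a₃_iff (ho : o ∉ ({a₁, a₃} : Set V)) (ω : Config E) :
    Conn ends ω a₁ a₃ ↔
      Conn ends (restrictTo (touches ends (cluster ends (sepConfig ends {a₁, a₃}) o)) ω) a₁ a₃ ∨
      Conn ends (restrictTo (touches ends (cluster ends (sepConfig ends {a₁, a₃}) o))ᶜ ω) a₁ a₃ := by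
  have ha₁ : a₁ ∈ ({a₁, a₃} : Set V) := by simp
  rw [conn_iff_of_not_mem ho (not_mem_cluster_of_mem_pair ho ha₁) ω a₃]
  constructor
  · rintro (h | ⟨k, hk, h₁k, hk₃⟩ | ⟨k, hk, k', hk', h₁k, hkk', hk'₃⟩)
    · exact Or.inr h
    · simp only [Set.mem_insert_iff, Set.mem_singleton_iff] at hk
      rcases hk with rfl | rfl
      · exact Or.inl hk₃
      · exact Or.inr h₁k
    · simp only [Set.mem_insert_iff, Set.mem_singleton_iff] at hk hk'
      rcases hk with rfl | rfl <;> rcases hk' with rfl | rfl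
      · exact Or.inr hk'₃
      · exact Or.inl hkk'
      · exact Or.inr h₁k
      · exact Or.inr h₁k
  · rintro (h | h)
    · exact Or.inr (Or.inl ⟨a₁, ha₁, conn_refl _ _ _, h⟩)
    · exact Or.inl h

/-- **(G7)** `a₂ ↔ a₃ ⟺ C₂ a₃ a₂ ∨ (C₁ a₁ a₃ ∧ C₂ a₁ a₂)`. -/
theorem conn_a₂a₃_iff (ho : o ∉ ({a₁, a₃} : Set V))
    (h₂ : a₂ ∉ cluster ends (sepConfig ends {a₁, a₃}) o ∪ {a₁, a₃}) (ω : Config E) :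
    Conn ends ω a₂ a₃ ↔
      Conn ends (restrictTo (touches ends (cluster ends (sepConfig ends {a₁, a₃}) o))ᶜ ω) a₃ a₂ ∨
      (Conn ends (restrictTo (touches ends (cluster ends (sepConfig ends {a₁, a₃}) o)) ω) a₁ a₃ ∧
        Conn ends (restrictTo (touches ends (cluster ends (sepConfig ends {a₁, a₃}) o))ᶜ ω) a₁ a₂) := by
  have ha₁ : a₁ ∈ ({a₁, a₃} : Set V) := by simp
  have ha₃ : a₃ ∈ ({a₁, a₃} : Set V) := by simp
  rw [conn_comm a₂ a₃, conn_iff_of_not_mem ho (not_mem_cluster_of_mem_pair ho ha₃) ω a₂]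
  constructor
  · rintro (h | ⟨k, hk, _, hk₂⟩ | ⟨k, hk, k', hk', h₃k, hkk', hk'₂⟩)
    · exact Or.inl h
    · exact absurd hk₂ (not_conn_restrictTo_of_not_mem_union ho (Or.inr hk) h₂ ω)
    · simp only [Set.mem_insert_iff, Set.mem_singleton_iff] at hk hk'
      rcases hk with rfl | rfl <;> rcases hk' with rfl | rfl
      · exact Or.inl (conn_trans h₃k hk'₂)
      · exact Or.inl hk'₂
      · exact Or.inr ⟨conn_symm hkk', hk'₂⟩
      · exact Or.inl hk'₂
  · rintro (h | ⟨hX, hY⟩)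
    · exact Or.inl h
    · exact Or.inr (Or.inr ⟨a₃, ha₃, a₁, ha₁, conn_refl _ _ _, conn_symm hX, hY⟩)

end Gates

end SepThreeGcZero

end Summit.Ventures.PercRepro2
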